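import Literature.RepresentationTheory.IntertwiningMapDirectSum     -- ★ `finrank_intertwiningMap_sup` (Hom additivity over an internal direct sum)
import Mathlib.Analysis.InnerProductSpace.Projection.Submodule
import Mathlib.Analysis.InnerProductSpace.Projection.FiniteDimensional
import HarnessLib

/-!
# Multiplicities along a filtration telescope over complements: `dim Hom_G(τ, F_n) = dim Hom_G(τ, F_0) + Σ_{m<n} dim Hom_G(τ, Q_{m+1})`

Topic `RepresentationTheory`; namespace `Literature.RepresentationTheory`; THEOREMS ONLY (no `def`, no named fact, no instance, no notation, no `sorry`);
Mathlib + ★ `IntertwiningMapDirectSum`.  Cell `hodgecm-mathlib`, F0∕P3, T1a arch line: node **N4b** (the additive half of the counting node N4) of the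
in-house road to the letter V19 ★ `IrreducibleUnitaryKTypeGrowth` at `U(2,1)` (skeleton draft `F0/P3/Lines-draft/T1a_V19_KTypeGrowthPaydown.A-p06g24.lean`;
N1 = the `𝔭`-filtration `F n` of A-p14 (g23); N4a = ★-to-be `IntertwiningMapExhaustion`).

THE STATEMENT ([KnappVogan1995, §I.3]; [Varadarajan1989, §5.4, proof of Thm. 19]; [BourbakiAlgebre1a3, Ch. II §1 no. 8]).  Let `R` be a representation of
a monoid `G` on `X`, `τ` a representation on `W`, and `F : ℕ → Subrepresentation R` a chain with COMPLEMENTS `Q (m+1)`: `F (m+1) = F m ⊔ Q (m+1)`,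
`F m ⊓ Q (m+1) = ⊥`.  Then `dim Hom_G(τ, F n) = dim Hom_G(τ, F 0) + Σ_{m<n} dim Hom_G(τ, Q (m+1))` (§1, pure algebra over ★ `finrank_intertwiningMap_sup`).
For a representation by ISOMETRIES of a GROUP on an inner product space (e.g. `K` acting through a unitary `ϖ` on the pre-Hilbert Harish-Chandra space),
every finite-dimensional `G`-stable `P ≤ P'` has the `G`-stable complement `P' ⊓ Pᗮ` (§2), so the complements exist for N1's filtration (§3).
HONEST LABEL: closes no registered stub by itself.  HC_CM is proved only modulo the 2 remaining named inputs (hLiu418, h413) until rung 0 closes.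

## References
* A. W. Knapp, D. A. Vogan, *Cohomological Induction and Unitary Representations* (1995), §I.3 [KnappVogan1995].
* V. S. Varadarajan, *An Introduction to Harmonic Analysis on Semisimple Lie Groups* (1989), §5.4 (proof of Thm. 19) [Varadarajan1989].
* N. Bourbaki, *Algèbre*, Ch. II §1 no. 8 Prop. 11 [BourbakiAlgebre1a3].
-/

set_option autoImplicit false

noncomputable section

namespace Literature.RepresentationTheory

open Representation
open scoped InnerProductSpace

universe u v w

/-! ## §1 Telescoping over complements (pure algebra) -/

section Telescope

variable {k : Type u} [Field k] {G : Type v} [Monoid G]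
  {X : Type w} [AddCommGroup X] [Module k X] {W : Type w} [AddCommGroup W] [Module k W]
  {R : Representation k G X} (τ : Representation k G W)

/-- **N4b (algebra): `dim Hom_G(τ, F n) = dim Hom_G(τ, F 0) + Σ_{m<n} dim Hom_G(τ, Q (m+1))`** for a chain of subrepresentations with complements
`F (m+1) = F m ⊔ Q (m+1)`, `F m ⊓ Q (m+1) = ⊥` (★ `finrank_intertwiningMap_sup`, induction on `n`).
[cite: BourbakiAlgebre1a3, Ch. II §1 no. 8 Prop. 11] [cite: KnappVogan1995, §I.3] -/
theorem finrank_intertwiningMap_eq_add_sum_of_compl (F Q : ℕ → Subrepresentation R)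
    (hsup : ∀ m, F (m + 1) = F m ⊔ Q (m + 1)) (hdisj : ∀ m, Disjoint (F m).toSubmodule (Q (m + 1)).toSubmodule)
    [∀ m, Module.Finite k (IntertwiningMap τ (F m).toRepresentation)] [∀ m, Module.Finite k (IntertwiningMap τ (Q m).toRepresentation)] (n : ℕ) :
    Module.finrank k (IntertwiningMap τ (F n).toRepresentation) =
      Module.finrank k (IntertwiningMap τ (F 0).toRepresentation) +
        ∑ m ∈ Finset.range n, Module.finrank k (IntertwiningMap τ (Q (m + 1)).toRepresentation) := by
  induction n with
  | zero => simp
  | succ n ih =>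
    rw [Finset.sum_range_succ, ← add_assoc, ← ih, hsup n]
    exact finrank_intertwiningMap_sup τ (F n) (Q (n + 1)) (hdisj n)

/-- Consequently `dim Hom_G(τ, F n) ≤ B` as soon as `dim Hom_G(τ, F 0) + Σ_{m<n} dim Hom_G(τ, Q (m+1)) ≤ B` (the form N4a's exhaustion consumes).
[cite: KnappVogan1995, §I.3] [cite: Varadarajan1989, §5.4 (proof of Thm. 19)] -/
theorem finrank_intertwiningMap_le_of_compl_of_sum_le (F Q : ℕ → Subrepresentation R)
    (hsup : ∀ m, F (m + 1) = F m ⊔ Q (m + 1)) (hdisj : ∀ m, Disjoint (F m).toSubmodule (Q (m + 1)).toSubmodule)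
    [∀ m, Module.Finite k (IntertwiningMap τ (F m).toRepresentation)] [∀ m, Module.Finite k (IntertwiningMap τ (Q m).toRepresentation)] {B : ℕ}
    (hB : ∀ n, Module.finrank k (IntertwiningMap τ (F 0).toRepresentation) +
      ∑ m ∈ Finset.range n, Module.finrank k (IntertwiningMap τ (Q (m + 1)).toRepresentation) ≤ B) (n : ℕ) :
    Module.finrank k (IntertwiningMap τ (F n).toRepresentation) ≤ B := by
  rw [finrank_intertwiningMap_eq_add_sum_of_compl τ F Q hsup hdisj n]
  exact hB n

end Telescope

/-! ## §2 Isometric actions: orthogonal complements of stable subspaces are stable -/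

section Isometric

variable {G : Type v} [Group G] {V : Type w} [NormedAddCommGroup V] [InnerProductSpace ℂ V] {σ : Representation ℂ G V}

/-- For a representation of a GROUP by ISOMETRIES (`⟪σ g v, σ g w⟫ = ⟪v, w⟫`), the orthogonal complement of a `G`-stable subspace is `G`-stable.
[cite: BourbakiAlgebre1a3, Ch. II §1 no. 8] [cite: KnappVogan1995, §I.3] -/
theorem apply_mem_orthogonal_of_isometry (hσ : ∀ (g : G) (v w : V), ⟪σ g v, σ g w⟫_ℂ = ⟪v, w⟫_ℂ) (P : Subrepresentation σ) (g : G) {v : V}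
    (hv : v ∈ P.toSubmoduleᗮ) : σ g v ∈ P.toSubmoduleᗮ := by
  rw [Submodule.mem_orthogonal] at hv ⊢
  intro u hu
  -- `⟪u, σ g v⟫ = ⟪σ g (σ g⁻¹ u), σ g v⟫ = ⟪σ g⁻¹ u, v⟫ = 0`
  have hu' : σ g⁻¹ u ∈ P.toSubmodule := P.apply_mem_toSubmodule g⁻¹ hu
  have h1 : σ g (σ g⁻¹ u) = u := by
    rw [← Module.End.mul_apply, ← map_mul, mul_inv_cancel, map_one, Module.End.one_apply]
  rw [← h1, hσ]
  exact hv _ hu'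

/-- **`G`-stable complements exist** for isometric actions of a group: for `G`-stable `P ≤ P'` with `P` finite-dimensional there is a `G`-stable `Q` with
`P' = P ⊔ Q`, `P ⊓ Q = ⊥`, namely `Q = P' ⊓ Pᗮ`. [cite: BourbakiAlgebre1a3, Ch. II §1 no. 8] [cite: KnappVogan1995, §I.3] -/
theorem exists_compl_subrepresentation_of_isometry (hσ : ∀ (g : G) (v w : V), ⟪σ g v, σ g w⟫_ℂ = ⟪v, w⟫_ℂ) (P P' : Subrepresentation σ)
    (hle : P ≤ P') [FiniteDimensional ℂ P.toSubmodule] :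
    ∃ Q : Subrepresentation σ, P' = P ⊔ Q ∧ Disjoint P.toSubmodule Q.toSubmodule ∧ Q.toSubmodule = P'.toSubmodule ⊓ P.toSubmoduleᗮ := by
  let Q : Subrepresentation σ :=
    { toSubmodule := P'.toSubmodule ⊓ P.toSubmoduleᗮ
      apply_mem_toSubmodule := fun g v hv => ⟨P'.apply_mem_toSubmodule g hv.1, apply_mem_orthogonal_of_isometry hσ P g hv.2⟩ }
  refine ⟨Q, ?_, ?_, rfl⟩
  · apply Subrepresentation.toSubmodule_injective
    rw [Subrepresentation.toSubmodule_sup]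
    change P'.toSubmodule = P.toSubmodule ⊔ P'.toSubmodule ⊓ P.toSubmoduleᗮ
    rw [inf_comm]
    exact (Submodule.sup_orthogonal_inf_of_hasOrthogonalProjection (K₁ := P.toSubmodule) (K₂ := P'.toSubmodule) hle).symm
  · change Disjoint P.toSubmodule (P'.toSubmodule ⊓ P.toSubmoduleᗮ)
    exact (Submodule.orthogonal_disjoint P.toSubmodule).mono_right inf_le_right

/-! ## §3 Complements along a finite-dimensional chain, and the telescope for isometric actions -/

/-- Along a MONOTONE chain of finite-dimensional `G`-stable subspaces of an isometric action there are `G`-stable complements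
`Q (m+1) = F (m+1) ⊓ (F m)ᗮ`: `F (m+1) = F m ⊔ Q (m+1)`, `F m ⊓ Q (m+1) = ⊥`. [cite: KnappVogan1995, §I.3] [cite: BourbakiAlgebre1a3, Ch. II §1 no. 8] -/
theorem exists_compl_chain_of_isometry (hσ : ∀ (g : G) (v w : V), ⟪σ g v, σ g w⟫_ℂ = ⟪v, w⟫_ℂ) (F : ℕ → Subrepresentation σ)
    (hmono : ∀ m, F m ≤ F (m + 1)) [∀ m, FiniteDimensional ℂ (F m).toSubmodule] :
    ∃ Q : ℕ → Subrepresentation σ, (∀ m, F (m + 1) = F m ⊔ Q (m + 1)) ∧ (∀ m, Disjoint (F m).toSubmodule (Q (m + 1)).toSubmodule) ∧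
      ∀ m, (Q (m + 1)).toSubmodule = (F (m + 1)).toSubmodule ⊓ (F m).toSubmoduleᗮ := by
  have h : ∀ m, ∃ Q : Subrepresentation σ, F (m + 1) = F m ⊔ Q ∧ Disjoint (F m).toSubmodule Q.toSubmodule ∧
      Q.toSubmodule = (F (m + 1)).toSubmodule ⊓ (F m).toSubmoduleᗮ := fun m =>
    exists_compl_subrepresentation_of_isometry hσ (F m) (F (m + 1)) (hmono m)
  choose Q hQ using h
  have hshift : ∀ m, (fun m => Q (m - 1)) (m + 1) = Q m := fun m => by simp only [Nat.add_sub_cancel]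
  refine ⟨fun m => Q (m - 1), fun m => ?_, fun m => ?_, fun m => ?_⟩
  · rw [hshift]
    exact (hQ m).1
  · rw [hshift]
    exact (hQ m).2.1
  · rw [hshift]
    exact (hQ m).2.2

/-- **N4b for isometric actions**: along a monotone chain `F` of finite-dimensional `G`-stable subspaces with the orthogonal complements `Q (m+1) =
F (m+1) ⊓ (F m)ᗮ` of `exists_compl_chain_of_isometry`, `dim Hom_G(τ, F n) = dim Hom_G(τ, F 0) + Σ_{m<n} dim Hom_G(τ, Q (m+1))` for every finite-dimensional
`τ`. [cite: KnappVogan1995, §I.3] [cite: Varadarajan1989, §5.4 (proof of Thm. 19)] -/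
theorem finrank_intertwiningMap_eq_add_sum_orthogonal {W : Type w} [AddCommGroup W] [Module ℂ W] [FiniteDimensional ℂ W] (τ : Representation ℂ G W)
    (F : ℕ → Subrepresentation σ)
    [∀ m, FiniteDimensional ℂ (F m).toSubmodule] (Q : ℕ → Subrepresentation σ)
    (hsup : ∀ m, F (m + 1) = F m ⊔ Q (m + 1)) (hdisj : ∀ m, Disjoint (F m).toSubmodule (Q (m + 1)).toSubmodule)
    (hQ : ∀ m, (Q (m + 1)).toSubmodule = (F (m + 1)).toSubmodule ⊓ (F m).toSubmoduleᗮ) (hQ0 : Q 0 = F 0) (n : ℕ) :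
    Module.finrank ℂ (IntertwiningMap τ (F n).toRepresentation) =
      Module.finrank ℂ (IntertwiningMap τ (F 0).toRepresentation) +
        ∑ m ∈ Finset.range n, Module.finrank ℂ (IntertwiningMap τ (Q (m + 1)).toRepresentation) := by
  -- every `Q m` is finite-dimensional, so all the Hom spaces are
  haveI hQfd : ∀ m, FiniteDimensional ℂ (Q m).toSubmodule := by
    intro m
    cases m with
    | zero => rw [hQ0]; infer_instance
    | succ m =>
      rw [hQ m]
      exact Submodule.finiteDimensional_inf_left _ _
  haveI : ∀ m, Module.Finite ℂ (IntertwiningMap τ (F m).toRepresentation) := fun m => inferInstance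
  haveI : ∀ m, Module.Finite ℂ (IntertwiningMap τ (Q m).toRepresentation) := fun m => inferInstance
  exact finrank_intertwiningMap_eq_add_sum_of_compl τ F Q hsup hdisj n

end Isometric

end Literature.RepresentationTheory

end
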